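import Summits.QuantumFields.YangMills.Theorems.BalabanLadderNTLinkEquipartition
import Summits.QuantumFields.YangMills.Theorems.BalabanLadderNTCouplingSumRuleBudget
import Summits.QuantumFields.YangMills.Theorems.LangevinControlUVOSLegsFromFemtoAndGapStubLowerAux
import Summits.QuantumFields.YangMills.Theorems.EquipartitionCriticalityEquipartitionPinsProbeLiePos
import Summits.QuantumFields.YangMills.Theorems.EquipartitionCriticalityEquipartitionPinsProbeTangentDefs
import Literature.MathematicalPhysics.QuantumFieldTheory.LatticeGaugeDobrushinPoincare
import Literature.MathematicalPhysics.QuantumFieldTheory.WilsonPlaquetteWeakCouplingFloor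
import HarnessLib

/-!
# Crux `NT` (stmt-QuantumFields-19353): the ONE-POINT FLOOR `c/β ≤ 6N − E_{T,β}[A_x]`, uniformly in the volume
# and (for the one-link kernels) in the exterior — hypothesis-free

Fleet lead prover of crux `NT` (unit `ym-spine-19353-p1`, g9).  Sequel of `Theorems/BalabanLadderNTLinkEquipartition`
(the one-link equipartition floor `(θ/(2β)) ∫ e^{−βu_k} dσ ≤ ∫ u_k e^{−βu_k} dσ`, uniform in the staples).  Here it is run
through the tree's DLR plumbing:

* §1 **kernel form** (`kernel_linkAction_ge`): for every dimension `d`, every link `e` of `ℤ^d` through which at least one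
  plaquette passes and EVERY exterior `ω`, the one-link lattice Yang–Mills kernel `γ_{e}(· | ω)` (tree `ymSpecification`)
  gives the link action `S_e = Σ_{p ∋ e} (N − Re tr ρ(U_p))` mean at least `θ/(2β)` for all `β ≥ β₀` — the one-link
  law is the Haar measure tilted by `−β S_e(ω^{e ← g})` (tree `integral_ymSpecification`) and `S_e(ω^{e ← g})` is the
  one-link cost against the staples (tree `wilsonBoundaryAction_singleton_update`); `θ, β₀` depend on `(G, ρ)` only;
  by consistency the same floor holds inside EVERY finite-volume kernel `γ_Λ(· | η)`, `e ∈ Λ` (`kernel_linkAction_ge_of_mem`):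
  no exterior freezes an interior link of a cube faster than `1/β` (the one-point currency of `RefPkgT` clause 1, from below);
* §2 **torus form**, `d = 4`, any lattice representation `r` of a compact `G` with `0 < dimE r.ρ` (automatic for compact
  SIMPLE `G`, `dimE_pos_of_isCompactSimpleLieGroup`): on every odd torus `2L+1 ≥ 5`, `E_{T,β}[S_e ∘ lift] ≥ θ/(2β)` (torus
  DLR, tree `integral_torusLift_eq_integral_kernel`), hence — all plaquette costs having the same mean (tree
  `wilsonExpectation_plaquetteCost_eq`) and at most `6` plaquettes passing through a link — the PLAQUETTE FLOOR
  `⟨φ_q⟩_{T,β} ≥ θ/(12β)` (`exists_plaquetteCost_ge`) and the crux-letter ONE-POINT FLOOR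
  **`exists_six_mul_sub_torusE_dens_ge`: `θ/(2β) ≤ 6N − E_{T,β}[A_x]` for all `β ≥ β₀`, all `L ≥ 2`, all sites `x`** —
  the floor twin of g8's chessboard ceiling `6N − E_{T,β}[A_x] ≤ 6K(1 + log β)/β` (`CouplingSumRule.exists_six_mul_sub_torusE_dens_le`).

HONEST FRAMING.  Volume-uniform equipartition FLOOR for the action density of lattice Yang–Mills with any compact gauge
group of positive dimension, at all large `β`, constants not sharp (the sharp `3D/2` is the tree's torus-LIMIT statement
`EquipartitionPinsProbe.stub_equipartition`); perturbatively visible (tree level), so it says nothing about NT's β-uniform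
two-point floor in a unit `a(β) → 0` (dimensional transmutation), the seam or the gap; not Clay.
Refs: Montvay–Münster 1994 §3.2; Chatterjee arXiv:1602.01222 Thm. 2.1; Seiler LNP 159 Ch. 2 (one-link DLR kernels).
-/

set_option autoImplicit false

noncomputable section

open scoped Matrix Matrix.Norms.Frobenius ENNReal NNReal Topology BigOperators
open MeasureTheory Measure Filter Set ProbabilityTheory
open Literature.MathematicalPhysics.QuantumLattice
open Literature.MathematicalPhysics.QuantumFieldTheory hiding ZdEdge
open Literature.Probability.LatticeModels (glueWith glueWith_apply_mem glueWith_apply_not_mem)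
open Summit.QuantumFields.YangMills.Theorems.FreeEnergyLogCoefficient (dimE)
open Summit.QuantumFields.YangMills.Cruxes.OSLegsFromFemtoAndGap.DlrCollarTransfer (torusE dens)
open Summit.QuantumFields.YangMills.Theorems.OSLegsFromFemtoAndGap.StubLower (integral_torusLift_eq_integral_kernel
  exists_near_of_mem_plaquetteEdges_touching)
open Summit.QuantumFields.YangMills.Cruxes.NT.CouplingSumRule (torusE_dens_eq_sum_orient)
open Summit.QuantumFields.YangMills.Theorems.CurvatureBoostCovariance.Negative (card_planes)

namespace Summit.QuantumFields.YangMills.Cruxes.NT.LinkEquipartition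

/-! ## §1 The one-link kernel floor, uniformly in the exterior -/

section Kernel

variable {N : ℕ} {G : Type*} [Group G] [TopologicalSpace G] [IsTopologicalGroup G] [CompactSpace G]
  [MeasurableSpace G] [BorelSpace G] [SecondCountableTopology G] (ρ : G →* Matrix (Fin N) (Fin N) ℂ)

omit [TopologicalSpace G] [IsTopologicalGroup G] [CompactSpace G] [MeasurableSpace G] [BorelSpace G]
  [SecondCountableTopology G] in
/-- **The one-link action after updating the link is the one-link cost against the staples**:
`S_e(ω^{e ← g}) = linkCost ρ (p ↦ staple_p^e(ω)) g` (tree `wilsonBoundaryAction_singleton_update`). [folklore] -/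
theorem wilsonBoundaryAction_update_eq_linkCost {d : ℕ} [DecidableEq (ZdEdge d)]
    (hU : ∀ g, ρ g ∈ Matrix.unitaryGroup (Fin N) ℂ) (e : ZdEdge d) (ω : LGConfig d G) (g : G) :
    wilsonBoundaryAction ρ {e} (Function.update ω e g) =
      linkCost ρ (fun p : ↥(plaquettesTouching {e}) => staple p.1 e ω) g := by
  rw [wilsonBoundaryAction_singleton_update ρ hU e ω g, linkCost, ← Finset.sum_coe_sort]
  simp only [map_mul]

omit [TopologicalSpace G] [IsTopologicalGroup G] [CompactSpace G] [MeasurableSpace G] [BorelSpace G]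
  [SecondCountableTopology G] in
/-- `|S_e(U)| ≤ 2(d−1) · 2N`: at most `2(d−1)` plaquettes pass through a link (tree `card_plaquettesTouching_singleton_le`)
and each cost lies in `[−2N, 2N]` (indeed in `[0, 2N]`). [folklore] -/
theorem abs_wilsonBoundaryAction_singleton_le {d : ℕ} (hU : ∀ g, ρ g ∈ Matrix.unitaryGroup (Fin N) ℂ)
    (e : ZdEdge d) (U : LGConfig d G) :
    |wilsonBoundaryAction ρ {e} U| ≤ (2 * (d - 1) : ℕ) * (2 * N) := by
  classical
  unfold wilsonBoundaryAction
  have hterm : ∀ p ∈ plaquettesTouching {e}, |((N : ℝ) - plaquetteObs ρ p.1 p.2.1.1 p.2.1.2 U)| ≤ 2 * N := by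
    intro p _
    have h := abs_le.1 (abs_plaquetteObs_le_holds ρ hU p.1 p.2.1.1 p.2.1.2 U)
    rw [abs_le]; constructor <;> linarith [h.1, h.2]
  calc |∑ p ∈ plaquettesTouching {e}, ((N : ℝ) - plaquetteObs ρ p.1 p.2.1.1 p.2.1.2 U)|
      ≤ ∑ p ∈ plaquettesTouching {e}, |((N : ℝ) - plaquetteObs ρ p.1 p.2.1.1 p.2.1.2 U)| := Finset.abs_sum_le_sum_abs _ _
    _ ≤ ∑ _p ∈ plaquettesTouching {e}, (2 * (N : ℝ)) := Finset.sum_le_sum hterm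
    _ = (plaquettesTouching {e}).card * (2 * N) := by rw [Finset.sum_const, nsmul_eq_mul]
    _ ≤ (2 * (d - 1) : ℕ) * (2 * N) := by
        have hc : ((plaquettesTouching {e}).card : ℝ) ≤ (2 * (d - 1) : ℕ) := by
          exact_mod_cast card_plaquettesTouching_singleton_le e
        exact mul_le_mul_of_nonneg_right hc (by positivity)

/-- **The one-link kernel mean of the link action as a ratio of tilted Haar integrals**:
`∫ S_e dγ_{e}(·|ω) = (∫ u e^{−βu} dσ)/(∫ e^{−βu} dσ)` with `u = linkCost ρ (staples of ω)`
(tree `integral_ymSpecification`; on the one-point index set gluing is `update ω e ∘ eval`). [folklore] -/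
theorem kernel_linkAction_eq_div {d : ℕ} [DecidableEq (ZdEdge d)] (hρ : Continuous ρ)
    (hU : ∀ g, ρ g ∈ Matrix.unitaryGroup (Fin N) ℂ) (β : ℝ) (e : ZdEdge d) (ω : LGConfig d G) :
    ∫ U, wilsonBoundaryAction ρ {e} U ∂(ymSpecification ρ β {e} ω) =
      (∫ g, linkCost ρ (fun p : ↥(plaquettesTouching {e}) => staple p.1 e ω) g *
          Real.exp (-β * linkCost ρ (fun p : ↥(plaquettesTouching {e}) => staple p.1 e ω) g) ∂(haarProbability G)) /
        ∫ g, Real.exp (-β * linkCost ρ (fun p : ↥(plaquettesTouching {e}) => staple p.1 e ω) g) ∂(haarProbability G) := by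
  set k : ↥(plaquettesTouching {e}) → G := fun p => staple p.1 e ω with hk
  have hSm : Measurable (wilsonBoundaryAction ρ {e} : LGConfig d G → ℝ) :=
    (continuous_wilsonBoundaryAction ρ hρ {e}).measurable
  rw [integral_ymSpecification ρ hρ β {e} hSm ω]
  -- gluing on the one-point index set is `update ω e ∘ eval`
  set ev : (↥({e} : Finset (ZdEdge d)) → G) → G := fun ζ => ζ ⟨e, Finset.mem_singleton_self e⟩ with hev
  have hgl : ∀ ζ : ↥({e} : Finset (ZdEdge d)) → G, glueWith {e} ζ ω = Function.update ω e (ev ζ) := by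
    intro ζ
    funext z
    by_cases hz : z = e
    · subst hz; simp [hev]
    · rw [Function.update_of_ne hz, glueWith_apply_not_mem _ _ _ (by simpa using hz)]
  have hmap : (Measure.pi fun _ : ↥({e} : Finset (ZdEdge d)) => haarProbability G).map ev = haarProbability G :=
    (MeasureTheory.measurePreserving_eval (fun _ : ↥({e} : Finset (ZdEdge d)) => haarProbability G)
      ⟨e, Finset.mem_singleton_self e⟩).map_eq
  have hevm : Measurable ev := measurable_pi_apply _
  have hu : ∀ g, wilsonBoundaryAction ρ {e} (Function.update ω e g) = linkCost ρ k g :=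
    fun g => wilsonBoundaryAction_update_eq_linkCost ρ hU e ω g
  have hcu : Continuous (linkCost ρ k) := continuous_linkCost ρ hρ k
  set F₁ : G → ℝ := fun g => linkCost ρ k g * Real.exp (-β * linkCost ρ k g) with hF₁
  set F₂ : G → ℝ := fun g => Real.exp (-β * linkCost ρ k g) with hF₂
  set π : Measure (↥({e} : Finset (ZdEdge d)) → G) := Measure.pi fun _ => haarProbability G with hπ
  have e1 : (fun ζ : ↥({e} : Finset (ZdEdge d)) → G =>
      wilsonBoundaryAction ρ {e} (glueWith {e} ζ ω) * Real.exp (-β * wilsonBoundaryAction ρ {e} (glueWith {e} ζ ω))) =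
      fun ζ => F₁ (ev ζ) := by
    funext ζ; simp only [hF₁, hgl, hu]
  have e2 : (fun ζ : ↥({e} : Finset (ZdEdge d)) → G => Real.exp (-β * wilsonBoundaryAction ρ {e} (glueWith {e} ζ ω))) =
      fun ζ => F₂ (ev ζ) := by
    funext ζ; simp only [hF₂, hgl, hu]
  have hc1 : Continuous F₁ := hcu.mul (Real.continuous_exp.comp (continuous_const.mul hcu))
  have hc2 : Continuous F₂ := Real.continuous_exp.comp (continuous_const.mul hcu)
  have H1 : ∫ ζ, F₁ (ev ζ) ∂π = ∫ g, F₁ g ∂(haarProbability G) := by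
    have h := integral_map (μ := π) hevm.aemeasurable (hc1.measurable.aestronglyMeasurable (μ := π.map ev))
    rw [hmap] at h
    exact h.symm
  have H2 : ∫ ζ, F₂ (ev ζ) ∂π = ∫ g, F₂ g ∂(haarProbability G) := by
    have h := integral_map (μ := π) hevm.aemeasurable (hc2.measurable.aestronglyMeasurable (μ := π.map ev))
    rw [hmap] at h
    exact h.symm
  rw [e1, e2, H1, H2]

/-- **THE ONE-LINK KERNEL FLOOR, UNIFORMLY IN THE EXTERIOR.**  For a compact group with a faithful continuous unitary
representation `ρ` of positive Lie dimension there are `θ, β₀ > 0` such that for every `β ≥ β₀`, every dimension `d`, every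
link `e` of `ℤ^d` lying on at least one plaquette and EVERY exterior configuration `ω`:
`θ/(2β) ≤ ∫ S_e dγ_{e}(· | ω)`, `S_e = Σ_{p ∋ e} (N − Re tr ρ(U_p))` — the boundary condition cannot freeze a link faster
than `1/β`. [folklore] -/
theorem kernel_linkAction_ge (hρ : Continuous ρ) (hinj : Function.Injective ρ)
    (hU : ∀ g, ρ g ∈ Matrix.unitaryGroup (Fin N) ℂ) (hD : 0 < dimE ρ) :
    ∃ θ β₀ : ℝ, 0 < θ ∧ 0 < β₀ ∧ ∀ β : ℝ, β₀ ≤ β → ∀ {d : ℕ} (e : ZdEdge d) (ω : LGConfig d G),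
      (plaquettesTouching {e}).Nonempty →
        θ / (2 * β) ≤ ∫ U, wilsonBoundaryAction ρ {e} U ∂(ymSpecification ρ β {e} ω) := by
  classical
  obtain ⟨θ, β₀, hθ, hβ₀, hfloor⟩ := linkCost_floor ρ hρ hinj hU hD
  refine ⟨θ, β₀, hθ, hβ₀, fun β hβ d e ω hne => ?_⟩
  haveI : Nonempty ↥(plaquettesTouching {e}) := hne.coe_sort
  set k : ↥(plaquettesTouching {e}) → G := fun p => staple p.1 e ω with hk
  rw [kernel_linkAction_eq_div ρ hρ hU β e ω]
  have hmain := hfloor β hβ ↥(plaquettesTouching {e}) k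
  -- the normaliser is positive
  have hcu : Continuous (linkCost ρ k) := continuous_linkCost ρ hρ k
  obtain ⟨B, hB⟩ : ∃ B, ∀ h, |linkCost ρ k h| ≤ B := by
    obtain ⟨B, hB⟩ := (isCompact_univ.image hcu).isBounded.exists_norm_le
    exact ⟨B, fun h => hB _ ⟨h, Set.mem_univ _, rfl⟩⟩
  have hβ0 : 0 < β := hβ₀.trans_le hβ
  have hZpos : 0 < ∫ g, Real.exp (-β * linkCost ρ k g) ∂(haarProbability G) := by
    have hle : ∀ g, Real.exp (-β * B) ≤ Real.exp (-β * linkCost ρ k g) := fun g =>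
      Real.exp_le_exp.2 (by nlinarith [le_abs_self (linkCost ρ k g), hB g])
    have hint : Integrable (fun g => Real.exp (-β * linkCost ρ k g)) (haarProbability G) :=
      integrable_of_continuous_of_abs_le (Real.continuous_exp.comp (continuous_const.mul hcu)) (C := 1) fun g => by
        rw [abs_of_pos (Real.exp_pos _)]
        exact Real.exp_le_one_iff.2 (by nlinarith [linkCost_nonneg ρ hU k g])
    calc (0 : ℝ) < Real.exp (-β * B) := Real.exp_pos _
      _ = ∫ _g, Real.exp (-β * B) ∂(haarProbability G) := by simp
      _ ≤ _ := integral_mono (integrable_const _) hint hle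
  rwa [le_div_iff₀ hZpos]

/-- **The same floor inside every finite-volume kernel** (consistency `γ_Λ γ_{e} = γ_Λ`, `e ∈ Λ`): for every finite link
set `Λ ∋ e` and EVERY exterior `η`, `θ/(2β) ≤ ∫ S_e dγ_Λ(· | η)` — no boundary condition freezes an interior link of a
cube (or of any finite region) faster than `1/β`. [folklore] -/
theorem kernel_linkAction_ge_of_mem (hρ : Continuous ρ) (hinj : Function.Injective ρ)
    (hU : ∀ g, ρ g ∈ Matrix.unitaryGroup (Fin N) ℂ) (hD : 0 < dimE ρ) :
    ∃ θ β₀ : ℝ, 0 < θ ∧ 0 < β₀ ∧ ∀ β : ℝ, β₀ ≤ β → ∀ {d : ℕ} (Λ : Finset (ZdEdge d)) (e : ZdEdge d), e ∈ Λ →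
      ∀ η : LGConfig d G, (plaquettesTouching {e}).Nonempty →
        θ / (2 * β) ≤ ∫ U, wilsonBoundaryAction ρ {e} U ∂(ymSpecification ρ β Λ η) := by
  obtain ⟨θ, β₀, hθ, hβ₀, hker⟩ := kernel_linkAction_ge ρ hρ hinj hU hD
  refine ⟨θ, β₀, hθ, hβ₀, fun β hβ d Λ e he η hne => ?_⟩
  haveI : T2Space G := T2Space.of_injective_continuous hinj hρ
  have hγ := isSpecification_ymSpecification_of_t2Space (d := d) ρ hρ β
  haveI := hγ.isProbability Λ η
  set F : LGConfig d G → ℝ := wilsonBoundaryAction ρ {e} with hF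
  have hFm : Measurable F := (continuous_wilsonBoundaryAction ρ hρ {e}).measurable
  have hFC := abs_wilsonBoundaryAction_singleton_le ρ hU e
  -- consistency in integral form: `∫ F dγ_Λ η = ∫ (∫ F dγ_{e} ζ) dγ_Λ η(ζ)`
  let κ : Kernel (LGConfig d G) (LGConfig d G) :=
    ⟨ymSpecification ρ β {e}, hγ.measurable_fun _⟩
  have hsub : ({e} : Finset (ZdEdge d)) ⊆ Λ := Finset.singleton_subset_iff.2 he
  have hbind : (ymSpecification ρ β Λ η).bind (ymSpecification ρ β {e}) = ymSpecification ρ β Λ η := by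
    ext B hB
    rw [Measure.bind_apply hB (hγ.measurable_fun _).aemeasurable]
    exact hγ.consistent hsub η B hB
  have hcomp : (κ ∘ₖ Kernel.const Unit (ymSpecification ρ β Λ η)) () = ymSpecification ρ β Λ η := by
    rw [Kernel.comp_apply, Kernel.const_apply]
    exact hbind
  have hfi : Integrable F ((κ ∘ₖ Kernel.const Unit (ymSpecification ρ β Λ η)) ()) := by
    rw [hcomp]
    exact Integrable.of_mem_Icc (-(((2 * (d - 1) : ℕ) : ℝ) * (2 * N))) (((2 * (d - 1) : ℕ) : ℝ) * (2 * N))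
      hFm.aemeasurable (ae_of_all _ fun U => abs_le.1 (hFC U))
  have key := Kernel.integral_comp hfi
  rw [hcomp, Kernel.const_apply] at key
  rw [key]
  -- the inner kernel means are all `≥ θ/(2β)`
  have hpt : ∀ ζ : LGConfig d G, θ / (2 * β) ≤ ∫ U, F U ∂(κ ζ) := fun ζ => hker β hβ e ζ hne
  have hcont : Continuous fun ζ : LGConfig d G => ∫ U, F U ∂(κ ζ) :=
    continuous_integral_ymSpecification ρ hρ β {e} (continuous_wilsonBoundaryAction ρ hρ {e}) hFC
  have hint : Integrable (fun ζ : LGConfig d G => ∫ U, F U ∂(κ ζ)) (ymSpecification ρ β Λ η) :=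
    Integrable.of_mem_Icc (-(((2 * (d - 1) : ℕ) : ℝ) * (2 * N))) (((2 * (d - 1) : ℕ) : ℝ) * (2 * N))
      hcont.measurable.aemeasurable (ae_of_all _ fun ζ => abs_le.1 (abs_integral_ymSpecification_le ρ hρ β {e} hFC ζ))
  calc θ / (2 * β) = ∫ _ζ, θ / (2 * β) ∂(ymSpecification ρ β Λ η) := by simp
    _ ≤ _ := integral_mono (integrable_const _) hint hpt

end Kernel

/-! ## §2 The torus: link-action floor, plaquette floor, one-point floor of the action density -/

section Torus

/-- In four dimensions every link lies on a plaquette (e.g. the one in the plane of its direction and another one). [folklore] -/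
theorem plaquettesTouching_singleton_nonempty (e : ZdEdge 4) : (plaquettesTouching {e}).Nonempty := by
  classical
  -- pick a direction `j ≠ e.2`
  obtain ⟨j, hj⟩ : ∃ j : Fin 4, j ≠ e.2 := by
    by_cases h : e.2 = 0
    · exact ⟨1, by rw [h]; decide⟩
    · exact ⟨0, fun h' => h h'.symm⟩
  rcases lt_or_gt_of_ne hj with hlt | hgt
  · -- `j < e.2`: the plaquette at `e.1` in the plane `(j, e.2)` has `e` as its fourth link
    refine ⟨(e.1, ⟨(j, e.2), hlt⟩), mem_plaquettesTouching_singleton.2 ?_⟩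
    rw [plaquetteEdges_eq]
    exact Finset.mem_insert_of_mem (Finset.mem_insert_of_mem (Finset.mem_insert_of_mem (Finset.mem_singleton.2 rfl)))
  · -- `e.2 < j`: the plaquette at `e.1` in the plane `(e.2, j)` has `e` as its first link
    refine ⟨(e.1, ⟨(e.2, j), hgt⟩), mem_plaquettesTouching_singleton.2 ?_⟩
    rw [plaquetteEdges_eq]
    exact Finset.mem_insert_self _ _

variable (G : Type) [Group G] [TopologicalSpace G] [IsTopologicalGroup G] [CompactSpace G]
  [MeasurableSpace G] [BorelSpace G] (r : LatticeRep G)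

omit [MeasurableSpace G] [BorelSpace G] in
/-- **Compact simple groups have positive Lie dimension** in every lattice representation (tree `stub_liePos` +
`dimE_eq_lieDim`). [folklore] -/
theorem dimE_pos_of_isCompactSimpleLieGroup (hG : IsCompactSimpleLieGroup G) :
    0 < dimE r.ρ := by
  rw [Summit.QuantumFields.YangMills.Theorems.EquipartitionPinsProbe.dimE_eq_lieDim r]
  exact Summit.QuantumFields.YangMills.Theorems.EquipartitionPinsProbe.stub_liePos G hG r

/-- **Torus link-action floor**: `θ/(2β) ≤ E_{T,β}[S_e ∘ lift]` on every odd torus `2L+1 ≥ 5`, every link `e` of `ℤ⁴`,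
every `β ≥ β₀` (torus DLR at the one link + the kernel floor pointwise in the sampled exterior). [folklore] -/
theorem torusE_linkAction_ge (hD : 0 < dimE r.ρ) :
    ∃ θ β₀ : ℝ, 0 < θ ∧ 0 < β₀ ∧ ∀ β : ℝ, β₀ ≤ β → ∀ (L : ℕ), 2 ≤ L → ∀ e : ZdEdge 4,
      θ / (2 * β) ≤ torusE G r β L (wilsonBoundaryAction r.ρ {e}) := by
  classical
  haveI := r.secondCountableTopology
  obtain ⟨θ, β₀, hθ, hβ₀, hker⟩ := kernel_linkAction_ge r.ρ r.continuous r.injective r.mem_unitary hD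
  refine ⟨θ, β₀, hθ, hβ₀, fun β hβ L hL e => ?_⟩
  haveI : NeZero (2 * L + 1) := ⟨by omega⟩
  haveI := isProbabilityMeasure_wilsonMeasure (d := 4) (L := 2 * L + 1) r.ρ r.continuous β
  have hF : Continuous (wilsonBoundaryAction r.ρ {e} : LGConfig 4 G → ℝ) :=
    continuous_wilsonBoundaryAction r.ρ r.continuous {e}
  have hC := abs_wilsonBoundaryAction_singleton_le r.ρ r.mem_unitary e
  have hcyl : IsCylinder (wilsonBoundaryAction r.ρ {e} : LGConfig 4 G → ℝ)
      ((plaquettesTouching {e}).biUnion plaquetteEdges) := isCylinder_wilsonBoundaryAction_holds r.ρ {e}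
  have hwin : ∀ e' ∈ ({e} : Finset (ZdEdge 4)) ∪ (plaquettesTouching {e}).biUnion plaquetteEdges, ∀ j,
      (e.1 j - 2) + 1 ≤ e'.1 j ∧ e'.1 j + 2 ≤ (e.1 j - 2) + ((2 * L + 1 : ℕ) : ℤ) := by
    intro e' he' j
    have hT : (5 : ℤ) ≤ ((2 * L + 1 : ℕ) : ℤ) := by push_cast; omega
    rcases Finset.mem_union.1 he' with h1 | h2
    · rw [Finset.mem_singleton] at h1
      subst h1
      constructor <;> omega
    · obtain ⟨e'', he'', hnear⟩ := exists_near_of_mem_plaquetteEdges_touching h2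
      rw [Finset.mem_singleton] at he''
      subst he''
      have := hnear j
      constructor <;> omega
  unfold torusE
  rw [integral_torusLift_eq_integral_kernel r.ρ r.continuous β {e} hF hC hcyl (2 * L + 1) (fun j => e.1 j - 2) hwin]
  have hpt : ∀ U : GaugeConfig 4 (2 * L + 1) G,
      θ / (2 * β) ≤ ∫ V, wilsonBoundaryAction r.ρ {e} V ∂(ymSpecification r.ρ β {e} (torusLift (2 * L + 1) U)) :=
    fun U => hker β hβ e _ (plaquettesTouching_singleton_nonempty e)
  have hcont : Continuous fun U : GaugeConfig 4 (2 * L + 1) G =>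
      ∫ V, wilsonBoundaryAction r.ρ {e} V ∂(ymSpecification r.ρ β {e} (torusLift (2 * L + 1) U)) :=
    (continuous_integral_ymSpecification r.ρ r.continuous β {e} hF hC).comp (continuous_torusLift _)
  have hint : Integrable (fun U : GaugeConfig 4 (2 * L + 1) G =>
      ∫ V, wilsonBoundaryAction r.ρ {e} V ∂(ymSpecification r.ρ β {e} (torusLift (2 * L + 1) U)))
      (wilsonMeasure (d := 4) (L := 2 * L + 1) r.ρ β) :=
    Integrable.mono' (integrable_const (((2 * (4 - 1) : ℕ) : ℝ) * (2 * (r.N : ℝ)))) hcont.measurable.aestronglyMeasurable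
      (ae_of_all _ fun U => by
        rw [Real.norm_eq_abs]
        exact abs_integral_ymSpecification_le r.ρ r.continuous β {e} hC _)
  calc θ / (2 * β) = ∫ _U, θ / (2 * β) ∂(wilsonMeasure (d := 4) (L := 2 * L + 1) r.ρ β) := by simp
    _ ≤ _ := integral_mono (integrable_const _) hint hpt

/-- **All plaquette costs of the torus have the same mean, so the link action has mean `#{p ∋ e} · ⟨φ_q⟩`.** [folklore] -/
theorem torusE_linkAction_eq_card_mul (β : ℝ) (L : ℕ) (e : ZdEdge 4) (q : Plaquette 4 (2 * L + 1)) :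
    torusE G r β L (wilsonBoundaryAction r.ρ {e}) =
      (plaquettesTouching {e}).card * ∫ U, plaquetteCost r.ρ U q ∂(wilsonMeasure (d := 4) (L := 2 * L + 1) r.ρ β) := by
  classical
  haveI := r.secondCountableTopology
  haveI := isProbabilityMeasure_wilsonMeasure (d := 4) (L := 2 * L + 1) r.ρ r.continuous β
  unfold torusE wilsonBoundaryAction
  have hterm : ∀ p ∈ plaquettesTouching {e},
      ∫ U, ((r.N : ℝ) - plaquetteObs r.ρ p.1 p.2.1.1 p.2.1.2 (torusLift (2 * L + 1) U))
        ∂(wilsonMeasure (d := 4) (L := 2 * L + 1) r.ρ β) =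
      ∫ U, plaquetteCost r.ρ U q ∂(wilsonMeasure (d := 4) (L := 2 * L + 1) r.ρ β) := by
    intro p _
    have h := wilsonExpectation_plaquetteCost_eq (d := 4) (L := 2 * L + 1) r.ρ r.continuous β
      (x := Literature.Probability.LatticeModels.Torus.proj (2 * L + 1) p.1) (x' := q.1)
      (i := p.2.1.1) (j := p.2.1.2) (i' := q.2.1.1) (j' := q.2.1.2) p.2.2.ne q.2.2.ne
    unfold wilsonExpectation at h
    simp only [plaquetteObs, ← plaquetteHolonomy_torusProj, plaquetteCost]
    exact h
  have hint : ∀ p ∈ plaquettesTouching {e}, Integrable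
      (fun U : GaugeConfig 4 (2 * L + 1) G => (r.N : ℝ) - plaquetteObs r.ρ p.1 p.2.1.1 p.2.1.2 (torusLift (2 * L + 1) U))
      (wilsonMeasure (d := 4) (L := 2 * L + 1) r.ρ β) := by
    intro p _
    refine Integrable.mono' (integrable_const (2 * (r.N : ℝ)))
      ((continuous_const.sub ((continuous_plaquetteObs r.ρ r.continuous _ _ _).comp
        (continuous_torusLift _))).measurable.aestronglyMeasurable) (ae_of_all _ fun U => ?_)
    have h := abs_le.1 (abs_plaquetteObs_le_holds r.ρ r.mem_unitary p.1 p.2.1.1 p.2.1.2 (torusLift (2 * L + 1) U))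
    rw [Real.norm_eq_abs, abs_le]
    constructor <;> linarith [h.1, h.2]
  rw [integral_finsetSum _ hint, Finset.sum_congr rfl hterm, Finset.sum_const, nsmul_eq_mul]

/-- **PLAQUETTE FLOOR, uniformly in the volume**: there are `c, β₀ > 0` with `c/β ≤ ⟨φ_q⟩_{T,β}` for every `β ≥ β₀`,
every odd torus `2L+1 ≥ 5` and every plaquette `q` (`φ_q = N − Re tr r(U_q)`). [folklore] -/
theorem exists_plaquetteCost_ge (hD : 0 < dimE r.ρ) :
    ∃ c β₀ : ℝ, 0 < c ∧ 0 < β₀ ∧ ∀ β : ℝ, β₀ ≤ β → ∀ (L : ℕ), 2 ≤ L → ∀ q : Plaquette 4 (2 * L + 1),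
      c / β ≤ ∫ U, plaquetteCost r.ρ U q ∂(wilsonMeasure (d := 4) (L := 2 * L + 1) r.ρ β) := by
  obtain ⟨θ, β₀, hθ, hβ₀, h⟩ := torusE_linkAction_ge G r hD
  refine ⟨θ / 12, β₀, by positivity, hβ₀, fun β hβ L hL q => ?_⟩
  have hβ0 : 0 < β := hβ₀.trans_le hβ
  set e : ZdEdge 4 := (0, 0) with he
  have h1 := h β hβ L hL e
  rw [torusE_linkAction_eq_card_mul G r β L e q] at h1
  have hcard : ((plaquettesTouching {e}).card : ℝ) ≤ 6 := by
    have := card_plaquettesTouching_singleton_le e; exact_mod_cast this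
  have hcard0 : (0 : ℝ) < (plaquettesTouching {e}).card := by
    exact_mod_cast (plaquettesTouching_singleton_nonempty e).card_pos
  set I := ∫ U, plaquetteCost r.ρ U q ∂(wilsonMeasure (d := 4) (L := 2 * L + 1) r.ρ β) with hI
  have hI0 : 0 ≤ I := by
    have : 0 ≤ ((plaquettesTouching {e}).card : ℝ) * I := (div_pos hθ (by positivity)).le.trans h1
    exact nonneg_of_mul_nonneg_right (by rwa [mul_comm] at this) hcard0 |> fun h => by
      rcases (mul_nonneg_iff_of_pos_left hcard0).1 (by linarith [this]) with h'
      exact h'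
  calc θ / 12 / β = θ / (2 * β) / 6 := by field_simp; ring
    _ ≤ (plaquettesTouching {e}).card * I / 6 := by gcongr
    _ ≤ 6 * I / 6 := by gcongr
    _ = I := by ring

/-- **THE ONE-POINT FLOOR OF THE ACTION DENSITY, uniformly in the volume**: there are `c, β₀ > 0` (depending on `(G, r)`
only) with `c/β ≤ 6N − E_{T,β}[A_x]` for every `β ≥ β₀`, every odd torus `2L+1 ≥ 5` and every site `x` — the floor twin of
`CouplingSumRule.exists_six_mul_sub_torusE_dens_le`. [folklore] -/
theorem exists_six_mul_sub_torusE_dens_ge (hD : 0 < dimE r.ρ) :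
    ∃ c β₀ : ℝ, 0 < c ∧ 0 < β₀ ∧ ∀ β : ℝ, β₀ ≤ β → ∀ (L : ℕ), 2 ≤ L → ∀ x : Fin 4 → ℤ,
      c / β ≤ 6 * (r.N : ℝ) - torusE G r β L (dens G r x) := by
  obtain ⟨c, β₀, hc, hβ₀, h⟩ := exists_plaquetteCost_ge G r hD
  refine ⟨6 * c, β₀, by positivity, hβ₀, fun β hβ L hL x => ?_⟩
  rw [torusE_dens_eq_sum_orient]
  have hsum : ∑ q : {q : Fin 4 × Fin 4 // q.1 < q.2}, c / β ≤
      ∑ q : {q : Fin 4 × Fin 4 // q.1 < q.2},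
        ∫ U, plaquetteCost r.ρ U (Literature.Probability.LatticeModels.Torus.proj (2 * L + 1) x, q)
          ∂(wilsonMeasure (d := 4) (L := 2 * L + 1) r.ρ β) :=
    Finset.sum_le_sum fun q _ => h β hβ L hL _
  rw [Finset.sum_const, Finset.card_univ, card_planes, nsmul_eq_mul] at hsum
  rw [Finset.sum_sub_distrib, Finset.sum_const, Finset.card_univ, card_planes, nsmul_eq_mul]
  push_cast at hsum ⊢
  have e6 : 6 * c / β = 6 * (c / β) := by ring
  linarith

/-- **The one-point floor for compact SIMPLE gauge groups** (no dimension hypothesis). [folklore] -/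
theorem exists_six_mul_sub_torusE_dens_ge_of_simple (hG : IsCompactSimpleLieGroup G) :
    ∃ c β₀ : ℝ, 0 < c ∧ 0 < β₀ ∧ ∀ β : ℝ, β₀ ≤ β → ∀ (L : ℕ), 2 ≤ L → ∀ x : Fin 4 → ℤ,
      c / β ≤ 6 * (r.N : ℝ) - torusE G r β L (dens G r x) :=
  exists_six_mul_sub_torusE_dens_ge G r (dimE_pos_of_isCompactSimpleLieGroup G r hG)

end Torus

end Summit.QuantumFields.YangMills.Cruxes.NT.LinkEquipartition

end
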